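import Summits.CriticalPhenomena.SAWScalingLimit.Theorems.SAWDevelopingMapObservableToSLETypeLadderCarvedReductionSqueezeCut
import Summits.CriticalPhenomena.SAWScalingLimit.Theorems.SAWDefectDecoherenceObservableToSLERCarvedReductionSqueezeTwoPiecePush
import Literature.Probability.RandomPlanarGeometry.PlanarDomainsTopology
import HarnessLib

/-!
# The two-piece flat super-domain cut out of a Jordan domain by two window cross-cuts
# (piece (G2′) of stub 5a4′ `stub_carvedReduction_squeeze`)

Piece of stub 5a4′ `stub_carvedReduction_squeeze` (`TwoPieceAdmRestrictionLimit → MovingCarvingSqueeze`)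
of the line `bridge-gate-renewal` (r9) of the crux `SAWDefectDecoherence.ObservableToSLER`
(stmt-CriticalPhenomena-14005; twin T2b′/T2b″ of stmt-CriticalPhenomena-10472), item (G2): the
common two-piece flat SUPER-DOMAIN `E` of the moving-carving squeeze.  It is cut out of an enlarged
Jordan domain `J` (a radial Schoenflies dilate `Dr r`, `r > 1`, of `D - τ`, piece `…JordanApprox` —
the pinned frame drifts, so `D - τ` itself is too small) by two disjoint cross-cuts `L i`, each
running along the horizontal window diameter of the closed gate ball `closedBall (g i) ρ ⊆ J` and
otherwise through lattice-free corridors to `∂J`.  This file is the cutting, independent of how the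
cross-cuts are produced: Newman's cross-cut theorem twice (keep the side of the bulk each time,
`TypeLadder.stub_carvedReduction_cutDomain` for the Dobrushin structure, re-marked at the window
centres), flatness from "the window ball minus its diameter is the two open half-discs; the upper
one is joined to the bulk, the lower one meets the other side because the diameter lies in that
side's frontier", and the containment of every point joined to the bulk off the cuts.

* `stub_carvedReduction_superDomainOfCrosscuts` — the statement `Squeeze.SuperDomainOfCrosscuts`
  of the w2 plan, proved.

Sources: M. H. A. Newman, Elements of the topology of plane sets of points (1939), Ch. V §11.
-/

noncomputable section
open scoped Topology
open Filter Set Metric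
open Literature.Probability.RandomPlanarGeometry
open Literature.Topology.PlaneTopology

namespace Summit.CriticalPhenomena.SAWScalingLimit.Theorems.ObservableToSLER.Squeeze

open Summit.CriticalPhenomena.SAWScalingLimit.Theorems.ObservableToSLE.TypeLadder
  (stub_carvedReduction_cutDomain)

/-! ### Elementary facts: simple arcs, window balls and their diameters -/

/-- A simple arc minus its two endpoints is connected, and both endpoints are in its closure. -/
theorem isConnected_diff_ends {L : Set ℂ} {a b : ℂ} (h : IsSimpleArc L a b) :
    IsConnected (L \ {a, b}) ∧ a ∈ closure (L \ {a, b}) ∧ b ∈ closure (L \ {a, b}) := by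
  obtain ⟨γ, hγc, hγi, hL, ha, hb⟩ := h
  have heq : L \ {a, b} = γ '' Ioo 0 1 := by
    ext z
    constructor
    · rintro ⟨hz, hne⟩
      rw [← hL] at hz
      obtain ⟨u, hu, rfl⟩ := hz
      have hu0 : u ≠ 0 := by rintro rfl; exact hne (Or.inl ha)
      have hu1 : u ≠ 1 := by rintro rfl; exact hne (Or.inr hb)
      exact ⟨u, ⟨lt_of_le_of_ne hu.1 (Ne.symm hu0), lt_of_le_of_ne hu.2 hu1⟩, rfl⟩
    · rintro ⟨u, hu, rfl⟩
      refine ⟨hL ▸ ⟨u, ⟨hu.1.le, hu.2.le⟩, rfl⟩, ?_⟩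
      rintro (h0 | h1)
      · rw [← ha] at h0
        have := hγi ⟨hu.1.le, hu.2.le⟩ ⟨le_rfl, zero_le_one⟩ h0
        exact hu.1.ne' this
      · rw [← hb] at h1
        have := hγi ⟨hu.1.le, hu.2.le⟩ ⟨zero_le_one, le_rfl⟩ h1
        exact hu.2.ne this
  have hsub : γ '' Icc 0 1 ⊆ closure (γ '' Ioo 0 1) := by
    have hc : ContinuousOn γ (closure (Ioo (0 : ℝ) 1)) := by rwa [closure_Ioo zero_ne_one]
    have := hc.image_closure
    rwa [closure_Ioo zero_ne_one] at this
  rw [heq]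
  refine ⟨(isConnected_Ioo zero_lt_one).image γ (hγc.mono Ioo_subset_Icc_self), ?_, ?_⟩
  · rw [← ha]; exact hsub ⟨0, ⟨le_rfl, zero_le_one⟩, rfl⟩
  · rw [← hb]; exact hsub ⟨1, ⟨zero_le_one, le_rfl⟩, rfl⟩

/-- Points of the horizontal diameter have the height of the centre. -/
theorem im_eq_of_mem_diameter {g z : ℂ} {ρ : ℝ} (hz : z ∈ segment ℝ (g - ρ) (g + ρ)) :
    z.im = g.im := by
  obtain ⟨a, b, -, -, hab, rfl⟩ := hz
  simp only [Complex.add_im, Complex.smul_im, Complex.sub_im, Complex.ofReal_im, sub_zero, add_zero,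
    smul_eq_mul]
  calc a * g.im + b * g.im = (a + b) * g.im := by ring
    _ = g.im := by rw [hab, one_mul]

/-- A point of the open window ball at the height of the centre lies on the diameter. -/
theorem mem_diameter_of_im_eq {g z : ℂ} {ρ : ℝ} (hz : z ∈ ball g ρ) (him : z.im = g.im) :
    z ∈ segment ℝ (g - ρ) (g + ρ) := by
  have hρ : 0 < ρ := dist_nonneg.trans_lt (mem_ball.1 hz)
  have hre : |z.re - g.re| < ρ := by
    have h1 : |(z - g).re| ≤ ‖z - g‖ := Complex.abs_re_le_norm _
    rw [Complex.sub_re] at h1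
    exact h1.trans_lt (mem_ball_iff_norm.1 hz)
  set μ : ℝ := (z.re - g.re + ρ) / (2 * ρ) with hμ
  have hre' := abs_lt.1 hre
  have hμ0 : 0 ≤ μ := div_nonneg (by linarith) (by positivity)
  have hμ1 : μ ≤ 1 := by rw [hμ, div_le_one (by positivity)]; linarith
  refine ⟨1 - μ, μ, by linarith, hμ0, by ring, ?_⟩
  apply Complex.ext
  · simp only [Complex.add_re, Complex.smul_re, Complex.sub_re, Complex.ofReal_re, smul_eq_mul]
    rw [hμ]; field_simp; ring
  · simp only [Complex.add_im, Complex.smul_im, Complex.sub_im, Complex.ofReal_im, sub_zero, add_zero,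
      smul_eq_mul, him]
    ring

/-- A point of the open window ball off the diameter is strictly above or strictly below it. -/
theorem im_lt_or_lt_of_not_mem_diameter {g z : ℂ} {ρ : ℝ} (hz : z ∈ ball g ρ)
    (hzs : z ∉ segment ℝ (g - ρ) (g + ρ)) : g.im < z.im ∨ z.im < g.im := by
  rcases lt_trichotomy g.im z.im with h | h | h
  · exact Or.inl h
  · exact absurd (mem_diameter_of_im_eq hz h.symm) hzs
  · exact Or.inr h

/-! ### One side of a cross-cut, chosen to contain a given point -/

/-- **The side of a cross-cut containing a point** (Newman): for a cross-cut `L` of the Jordan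
domain `D₁` between the boundary points of parameters `s < t < s + 1` and a point `b ∈ D₁ ∖ L`,
`D₁ ∖ L = X ⊔ Y` with `X ∋ b`, `X`, `Y` open, connected, nonempty, `L ⊆ ∂Y` and
`∂X ⊆ L ∪ ∂D₁`. -/
theorem exists_side_of_mem (D₁ : JordanDomain) {L : Set ℂ} {s t : ℝ} (hst : s < t) (hts : t < s + 1)
    (hL : D₁.IsCrosscut L (D₁.boundary s) (D₁.boundary t)) {b : ℂ} (hb : b ∈ D₁.carrier)
    (hbL : b ∉ L) :
    ∃ X Y : Set ℂ, IsOpen X ∧ IsOpen Y ∧ IsConnected X ∧ IsConnected Y ∧ Disjoint X Y ∧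
      X ∪ Y = D₁.carrier \ L ∧ b ∈ X ∧ L ⊆ frontier Y ∧ frontier X ⊆ L ∪ frontier D₁.carrier := by
  obtain ⟨U₁, U₂, h₁o, h₂o, h₁c, h₂c, hdisj, hunion, hf₁, hf₂⟩ :=
    Newman1939_crosscut_holds D₁ L s t hst hts hL
  have hfr : ∀ (S : Set ℝ), L ∪ D₁.boundary '' S ⊆ L ∪ frontier D₁.carrier := fun S =>
    union_subset_union_right _ (by rw [← D₁.range_boundary]; exact image_subset_range _ _)
  have hbU : b ∈ U₁ ∪ U₂ := by rw [hunion]; exact ⟨hb, hbL⟩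
  rcases hbU with hb₁ | hb₂
  · refine ⟨U₁, U₂, h₁o, h₂o, h₁c, h₂c, hdisj, hunion, hb₁, ?_, ?_⟩
    · rw [hf₂]; exact subset_union_left
    · rw [hf₁]; exact hfr _
  · refine ⟨U₂, U₁, h₂o, h₁o, h₂c, h₁c, hdisj.symm, by rw [union_comm, hunion], hb₂, ?_, ?_⟩
    · rw [hf₁]; exact subset_union_left
    · rw [hf₂]; exact hfr _

/-- A connected subset of `X ∪ Y` (open, disjoint) meeting `X` lies in `X`. -/
theorem subset_side {X Y P : Set ℂ} (hXo : IsOpen X) (hYo : IsOpen Y) (hXY : Disjoint X Y)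
    (hP : IsPreconnected P) (hPXY : P ⊆ X ∪ Y) {b : ℂ} (hbP : b ∈ P) (hbX : b ∈ X) : P ⊆ X :=
  hP.subset_left_of_subset_union hXo hYo hXY hPXY ⟨b, hbP, hbX⟩

/-! ### The super-domain -/

/-- **Registered sub-goal `stub_carvedReduction_superDomainOfCrosscuts`** (crux item
stmt-CriticalPhenomena-14005, stub 5a4′ `stub_carvedReduction_squeeze`, piece (G2′) THE TWO-PIECE
FLAT SUPER-DOMAIN FROM TWO WINDOW CROSS-CUTS): see the module docstring (this is the typed
statement `Squeeze.SuperDomainOfCrosscuts` of the w2 plan). [cite: Newman1939, Ch. V §11, Thms. 11·7 and 11·8, pp. 94–95] -/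
theorem stub_carvedReduction_superDomainOfCrosscuts :
    ∀ (J : JordanDomain) (g : Fin 2 → ℂ) (ρ : ℝ) (L : Fin 2 → Set ℂ) (x : Fin 2 → Fin 2 → ℂ),
      0 < ρ → (∀ i, closedBall (g i) ρ ⊆ J.carrier) →
      (∀ i, J.IsCrosscut (L i) (x i 0) (x i 1)) → Disjoint (L 0) (L 1) →
      (∀ i, L i ∩ closedBall (g i) ρ = segment ℝ (g i - ρ) (g i + ρ)) →
      Disjoint (L 0) (closedBall (g 1) ρ) → Disjoint (L 1) (closedBall (g 0) ρ) →
      JoinedIn (J.carrier \ (L 0 ∪ L 1)) (g 0 + ((ρ / 2 : ℝ) : ℂ) * Complex.I)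
        (g 1 + ((ρ / 2 : ℝ) : ℂ) * Complex.I) →
      ∃ E : DobrushinDomain, E.pt 0 = g 0 ∧ E.pt 1 = g 1 ∧ E.carrier ⊆ J.carrier \ (L 0 ∪ L 1) ∧
        (∀ z : ℂ, JoinedIn (J.carrier \ (L 0 ∪ L 1)) z (g 0 + ((ρ / 2 : ℝ) : ℂ) * Complex.I) →
          z ∈ E.carrier) ∧
        (∀ i, E.carrier ∩ ball (g i) ρ = {z : ℂ | (g i).im < z.im} ∩ ball (g i) ρ) ∧
        frontier E.carrier ⊆ L 0 ∪ L 1 ∪ frontier J.carrier := by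
  intro J g ρ L x hρ hball hcut hdisj hdiam hfar0 hfar1 hlink
  classical
  -- the bulk points above the window centres, the half-discs
  set b : Fin 2 → ℂ := fun i => g i + ((ρ / 2 : ℝ) : ℂ) * Complex.I with hbdef
  set up : Fin 2 → Set ℂ := fun i => {z : ℂ | (g i).im < z.im} ∩ ball (g i) ρ with hup
  set lo : Fin 2 → Set ℂ := fun i => {z : ℂ | z.im < (g i).im} ∩ ball (g i) ρ with hlo
  have hbball : ∀ i, b i ∈ ball (g i) ρ := fun i => by
    rw [mem_ball, hbdef]; simp only
    rw [dist_eq_norm, add_sub_cancel_left, norm_mul, Complex.norm_real, Complex.norm_I, mul_one,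
      Real.norm_of_nonneg (by positivity)]; linarith
  have hbim : ∀ i, (g i).im < (b i).im := fun i => by rw [hbdef]; simp; positivity
  have hbup : ∀ i, b i ∈ up i := fun i => ⟨hbim i, hbball i⟩
  have hbJ : ∀ i, b i ∈ J.carrier := fun i => hball i (ball_subset_closedBall (hbball i))
  have hseg : ∀ i, segment ℝ (g i - ρ) (g i + ρ) ⊆ L i := fun i => by
    rw [← hdiam i]; exact inter_subset_left
  have hgL : ∀ i, g i ∈ L i := fun i =>
    hseg i ⟨1 / 2, 1 / 2, by norm_num, by norm_num, by norm_num, by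
      rw [Complex.real_smul, Complex.real_smul]; push_cast; ring⟩
  -- points of `L j` in the window ball `i`
  have hfar : ∀ i j, i ≠ j → Disjoint (L j) (closedBall (g i) ρ) := by
    intro i j hij
    fin_cases i <;> fin_cases j
    · exact absurd rfl hij
    · exact hfar1
    · exact hfar0
    · exact absurd rfl hij
  have hLball : ∀ i j z, z ∈ ball (g i) ρ → z ∈ L j → z ∈ segment ℝ (g i - ρ) (g i + ρ) ∧ i = j := by
    intro i j z hz hzL
    by_cases hij : i = j
    · subst hij
      have : z ∈ L i ∩ closedBall (g i) ρ := ⟨hzL, ball_subset_closedBall hz⟩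
      rw [hdiam i] at this
      exact ⟨this, rfl⟩
    · exact absurd (ball_subset_closedBall hz) (Set.disjoint_left.1 (hfar i j hij) hzL)
  have hupL : ∀ i j, Disjoint (up i) (L j) := by
    intro i j
    refine Set.disjoint_left.2 fun z hz hzL => ?_
    obtain ⟨hzs, -⟩ := hLball i j z hz.2 hzL
    have h1 := im_eq_of_mem_diameter hzs; have h2 : (g i).im < z.im := hz.1; linarith
  have hloL : ∀ i j, Disjoint (lo i) (L j) := by
    intro i j
    refine Set.disjoint_left.2 fun z hz hzL => ?_
    obtain ⟨hzs, -⟩ := hLball i j z hz.2 hzL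
    have h1 := im_eq_of_mem_diameter hzs; have h2 : z.im < (g i).im := hz.1; linarith
  have hbL : ∀ i j, b i ∉ L j := fun i j h => Set.disjoint_left.1 (hupL i j) (hbup i) h
  have hupc : ∀ i, IsConnected (up i) := fun i =>
    ((convex_halfSpace_im_gt _).inter (convex_ball _ _)).isConnected ⟨b i, hbup i⟩
  have hloc : ∀ i, IsConnected (lo i) := fun i =>
    ((convex_halfSpace_im_lt _).inter (convex_ball _ _)).isConnected
      ⟨g i - ((ρ / 2 : ℝ) : ℂ) * Complex.I, by
        refine ⟨?_, ?_⟩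
        · show (g i - ((ρ / 2 : ℝ) : ℂ) * Complex.I).im < (g i).im
          simp; positivity
        · rw [mem_ball, dist_eq_norm, sub_sub_cancel_left, norm_neg, norm_mul, Complex.norm_real,
            Complex.norm_I, mul_one, Real.norm_of_nonneg (by positivity)]
          linarith⟩
  have hupJ : ∀ i, up i ⊆ J.carrier := fun i z hz => hball i (ball_subset_closedBall hz.2)
  -- the window centres lie in the closures of the upper half-discs and are distinct interior points
  have hgcl : ∀ i, g i ∈ closure (up i) := fun i =>
    center_mem_closure_of_flat (Ω := up i) hρ (by rw [hup]; simp only; rw [inter_assoc, inter_self])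
  have hgJ : ∀ i, g i ∈ J.carrier := fun i => hball i (mem_closedBall_self hρ.le)
  have hg01 : g 0 ≠ g 1 := fun h =>
    Set.disjoint_left.1 hfar0 (hgL 0) (by rw [h]; exact mem_closedBall_self hρ.le)
  have hxfr : ∀ i k, x i k ∈ frontier J.carrier := by
    intro i k; fin_cases k
    · exact (hcut i).2.1
    · exact (hcut i).2.2.1
  have hxJ : ∀ i k, x i k ∉ J.carrier := fun i k h =>
    Set.disjoint_left.1 J.disjoint_carrier_frontier h (hxfr i k)
  -- the link path
  set P : Set ℂ := range hlink.somePath with hP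
  have hPc : IsConnected P := isConnected_range hlink.somePath.continuous
  have hPsub : P ⊆ J.carrier \ (L 0 ∪ L 1) := by
    rintro _ ⟨u, rfl⟩; exact hlink.somePath_mem u
  have hb0P : b 0 ∈ P := ⟨0, hlink.somePath.source⟩
  have hb1P : b 1 ∈ P := ⟨1, hlink.somePath.target⟩
  -- FIRST CUT: parameters of the endpoints of `L 0`
  obtain ⟨s₀, hs₀⟩ : ∃ s₀, J.boundary s₀ = x 0 0 := by
    have := hxfr 0 0; rw [← J.range_boundary] at this; exact this
  obtain ⟨t₀, ht₀I, ht₀⟩ : ∃ t₀ ∈ Ioo s₀ (s₀ + 1), J.boundary t₀ = x 0 1 := by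
    have h := hxfr 0 1
    rw [← J.range_boundary] at h
    obtain ⟨v, hv⟩ := h
    obtain ⟨w, hw, hwv⟩ := J.periodic_boundary.exists_mem_Ico one_pos v s₀
    refine ⟨w, ⟨lt_of_le_of_ne hw.1 ?_, hw.2⟩, by rw [← hwv, hv]⟩
    rintro rfl
    have : x 0 0 = x 0 1 := by rw [← hs₀, ← hwv, hv]
    exact (hcut 0).2.2.2.1 this
  have hcut0 : J.IsCrosscut (L 0) (J.boundary s₀) (J.boundary t₀) := by rw [hs₀, ht₀]; exact hcut 0
  obtain ⟨X₀, Y₀, hX₀o, hY₀o, hX₀c, hY₀c, hXY₀, hun₀, hbX₀, hLY₀, hfrX₀⟩ :=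
    exists_side_of_mem J ht₀I.1 ht₀I.2 hcut0 (hbJ 0) (hbL 0 0)
  -- what lies in `X₀`
  have hsub₀ : ∀ {S : Set ℂ}, IsPreconnected S → S ⊆ J.carrier → Disjoint S (L 0) →
      ∀ {c}, c ∈ S → c ∈ X₀ → S ⊆ X₀ := by
    intro S hS hSJ hSL c hcS hcX
    refine subset_side hX₀o hY₀o hXY₀ hS ?_ hcS hcX
    rw [hun₀]; exact fun z hz => ⟨hSJ hz, Set.disjoint_left.1 hSL hz⟩
  have hPX₀ : P ⊆ X₀ := hsub₀ hPc.isPreconnected (fun z hz => (hPsub hz).1)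
    (Set.disjoint_left.2 fun z hz hzL => (hPsub hz).2 (Or.inl hzL)) hb0P hbX₀
  have hball1X₀ : ball (g 1) ρ ⊆ X₀ :=
    hsub₀ (convex_ball _ _).isPreconnected (fun z hz => hball 1 (ball_subset_closedBall hz))
      (Set.disjoint_left.2 fun z hz hzL => Set.disjoint_left.1 hfar0 hzL (ball_subset_closedBall hz))
      (hbball 1) (hPX₀ hb1P)
  have hup0X₀ : up 0 ⊆ X₀ := hsub₀ (hupc 0).isPreconnected (hupJ 0) (hupL 0 0) (hbup 0) hbX₀
  -- `L 1` minus its ends runs inside `X₀`; its ends are frontier points of `X₀`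
  obtain ⟨hL1c, hx10cl, hx11cl⟩ := isConnected_diff_ends (hcut 1).1
  have hL1J : L 1 \ {x 1 0, x 1 1} ⊆ J.carrier := (hcut 1).2.2.2.2
  have hg1L' : g 1 ∈ L 1 \ {x 1 0, x 1 1} := by
    refine ⟨hgL 1, ?_⟩
    rintro (h | h)
    · exact hxJ 1 0 (h ▸ hgJ 1)
    · exact hxJ 1 1 (h ▸ hgJ 1)
  have hL1X₀ : L 1 \ {x 1 0, x 1 1} ⊆ X₀ :=
    hsub₀ hL1c.isPreconnected hL1J (Set.disjoint_left.2 fun z hz hz0 => Set.disjoint_left.1 hdisj hz0 hz.1)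
      hg1L' (hball1X₀ (mem_ball_self hρ))
  have hx1cl : ∀ k, x 1 k ∈ closure X₀ ∧ x 1 k ∉ X₀ := by
    intro k
    refine ⟨?_, fun h => hxJ 1 k (by
      have : x 1 k ∈ X₀ ∪ Y₀ := Or.inl h
      rw [hun₀] at this
      exact this.1)⟩
    fin_cases k
    · exact closure_mono hL1X₀ hx10cl
    · exact closure_mono hL1X₀ hx11cl
  -- the first side as a Dobrushin domain marked at the ends of `L 1`
  obtain ⟨D₂, hD₂, hD₂0, hD₂1⟩ := stub_carvedReduction_cutDomain J (L 0) s₀ t₀ X₀ Y₀ (x 1 0) (x 1 1)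
    ht₀I.1 ht₀I.2 hcut0 hX₀o hY₀o hXY₀ ⟨b 0, hbX₀⟩ hY₀c.nonempty hun₀ (hcut 1).2.2.2.1
    (hx1cl 0).1 (hx1cl 0).2 (hx1cl 1).1 (hx1cl 1).2
  -- SECOND CUT, in `D₂`
  have hfrX₀eq : frontier X₀ = closure X₀ \ X₀ := by rw [frontier, hX₀o.interior_eq]
  have hcut1 : D₂.toJordanDomain.IsCrosscut (L 1) (D₂.boundary (D₂.mark 0)) (D₂.boundary (D₂.mark 1)) := by
    rw [show D₂.boundary (D₂.mark 0) = x 1 0 from hD₂0, show D₂.boundary (D₂.mark 1) = x 1 1 from hD₂1]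
    refine ⟨(hcut 1).1, ?_, ?_, (hcut 1).2.2.2.1, ?_⟩
    · show x 1 0 ∈ frontier D₂.carrier
      rw [hD₂, hfrX₀eq]; exact hx1cl 0
    · show x 1 1 ∈ frontier D₂.carrier
      rw [hD₂, hfrX₀eq]; exact hx1cl 1
    · show L 1 \ {x 1 0, x 1 1} ⊆ D₂.carrier
      rw [hD₂]; exact hL1X₀
  have hm01 : D₂.mark 0 < D₂.mark 1 := D₂.strictMono_mark (by decide)
  have hm10 : D₂.mark 1 < D₂.mark 0 + 1 := by linarith [(D₂.mark_mem 1).2, (D₂.mark_mem 0).1]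
  obtain ⟨E₀, Y₁, hE₀o, hY₁o, -, hY₁c, hEY₁, hun₁, hbE₀, hLY₁, hfrE₀⟩ :=
    exists_side_of_mem D₂.toJordanDomain hm01 hm10 hcut1 (show b 0 ∈ D₂.carrier by rw [hD₂]; exact hbX₀)
      (hbL 0 1)
  rw [hD₂] at hun₁ hfrE₀
  -- what lies in `E₀`
  have hsub₁ : ∀ {S : Set ℂ}, IsPreconnected S → S ⊆ X₀ → Disjoint S (L 1) →
      ∀ {c}, c ∈ S → c ∈ E₀ → S ⊆ E₀ := by
    intro S hS hSX hSL c hcS hcE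
    refine subset_side hE₀o hY₁o hEY₁ hS ?_ hcS hcE
    rw [hun₁]; exact fun z hz => ⟨hSX hz, Set.disjoint_left.1 hSL hz⟩
  have hPE₀ : P ⊆ E₀ := hsub₁ hPc.isPreconnected hPX₀
    (Set.disjoint_left.2 fun z hz hzL => (hPsub hz).2 (Or.inr hzL)) hb0P hbE₀
  have hup0E₀ : up 0 ⊆ E₀ := hsub₁ (hupc 0).isPreconnected hup0X₀ (hupL 0 1) (hbup 0) hbE₀
  have hup1E₀ : up 1 ⊆ E₀ := hsub₁ (hupc 1).isPreconnected ((fun z hz => hball1X₀ hz.2))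
    (hupL 1 1) (hbup 1) (hPE₀ hb1P)
  have hE₀sub : E₀ ⊆ J.carrier \ (L 0 ∪ L 1) := by
    intro z hz
    have h1 : z ∈ X₀ \ L 1 := by rw [← hun₁]; exact Or.inl hz
    have h0 : z ∈ J.carrier \ L 0 := by rw [← hun₀]; exact Or.inl h1.1
    exact ⟨h0.1, fun h => h.elim h0.2 h1.2⟩
  -- the lower half-discs lie on the other sides
  have hlo0 : Disjoint (lo 0) E₀ := by
    -- `g 0 ∈ L 0 ⊆ ∂Y₀`: a point of `Y₀` in the window ball is below the diameter
    have hg0Y : g 0 ∈ closure Y₀ := frontier_subset_closure (hLY₀ (hgL 0))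
    obtain ⟨y, hyY, hyd⟩ := Metric.mem_closure_iff.1 hg0Y ρ hρ
    have hyball : y ∈ ball (g 0) ρ := by rw [mem_ball, dist_comm]; exact hyd
    have hyJL : y ∈ J.carrier \ L 0 := by rw [← hun₀]; exact Or.inr hyY
    have hyX : y ∉ X₀ := fun h => Set.disjoint_left.1 hXY₀ h hyY
    have hylo : y ∈ lo 0 := by
      rcases im_lt_or_lt_of_not_mem_diameter hyball (fun h => hyJL.2 (hseg 0 h)) with h | h
      · exact absurd (hup0X₀ ⟨h, hyball⟩) hyX
      · exact ⟨h, hyball⟩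
    have hloY : lo 0 ⊆ Y₀ := by
      refine (hloc 0).isPreconnected.subset_right_of_subset_union hX₀o hY₀o hXY₀ ?_ ⟨y, hylo, hyY⟩
      rw [hun₀]; exact fun z hz => ⟨hball 0 (ball_subset_closedBall hz.2), Set.disjoint_left.1 (hloL 0 0) hz⟩
    exact Set.disjoint_left.2 fun z hz hzE => by
      have : z ∈ E₀ ∪ Y₁ := Or.inl hzE
      rw [hun₁] at this
      exact Set.disjoint_left.1 hXY₀ this.1 (hloY hz)
  have hlo1 : Disjoint (lo 1) E₀ := by
    have hg1Y : g 1 ∈ closure Y₁ := frontier_subset_closure (hLY₁ (hgL 1))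
    obtain ⟨y, hyY, hyd⟩ := Metric.mem_closure_iff.1 hg1Y ρ hρ
    have hyball : y ∈ ball (g 1) ρ := by rw [mem_ball, dist_comm]; exact hyd
    have hyXL : y ∈ X₀ \ L 1 := by rw [← hun₁]; exact Or.inr hyY
    have hyE : y ∉ E₀ := fun h => Set.disjoint_left.1 hEY₁ h hyY
    have hylo : y ∈ lo 1 := by
      rcases im_lt_or_lt_of_not_mem_diameter hyball (fun h => hyXL.2 (hseg 1 h)) with h | h
      · exact absurd (hup1E₀ ⟨h, hyball⟩) hyE
      · exact ⟨h, hyball⟩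
    have hloY : lo 1 ⊆ Y₁ := by
      refine (hloc 1).isPreconnected.subset_right_of_subset_union hE₀o hY₁o hEY₁ ?_ ⟨y, hylo, hyY⟩
      rw [hun₁]; exact fun z hz => ⟨hball1X₀ hz.2, Set.disjoint_left.1 (hloL 1 1) hz⟩
    exact Set.disjoint_left.2 fun z hz hzE => Set.disjoint_left.1 hEY₁ hzE (hloY hz)
  -- the super-domain: `E₀`, re-marked at the window centres
  have hg0cl : g 0 ∈ closure E₀ := closure_mono hup0E₀ (hgcl 0)
  have hg1cl : g 1 ∈ closure E₀ := closure_mono hup1E₀ (hgcl 1)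
  obtain ⟨E, hE, hE0, hE1⟩ := stub_carvedReduction_cutDomain D₂.toJordanDomain (L 1) (D₂.mark 0) (D₂.mark 1)
    E₀ Y₁ (g 0) (g 1) hm01 hm10 hcut1 hE₀o hY₁o hEY₁ ⟨b 0, hbE₀⟩ hY₁c.nonempty (by rw [hun₁, hD₂]) hg01
    hg0cl (fun h => (hE₀sub h).2 (Or.inl (hgL 0))) hg1cl (fun h => (hE₀sub h).2 (Or.inr (hgL 1)))
  refine ⟨E, hE0, hE1, by rw [hE]; exact hE₀sub, fun z hz => ?_, fun i => ?_, ?_⟩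
  · -- points joined to the bulk off the cuts
    rw [hE]
    set Q : Set ℂ := range hz.somePath with hQ
    have hQc : IsConnected Q := isConnected_range hz.somePath.continuous
    have hQsub : Q ⊆ J.carrier \ (L 0 ∪ L 1) := by rintro _ ⟨u, rfl⟩; exact hz.somePath_mem u
    have hbQ : b 0 ∈ Q := ⟨1, hz.somePath.target⟩
    have hQX₀ : Q ⊆ X₀ := hsub₀ hQc.isPreconnected (fun w hw => (hQsub hw).1)
      (Set.disjoint_left.2 fun w hw hwL => (hQsub hw).2 (Or.inl hwL)) hbQ hbX₀
    have hQE₀ : Q ⊆ E₀ := hsub₁ hQc.isPreconnected hQX₀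
      (Set.disjoint_left.2 fun w hw hwL => (hQsub hw).2 (Or.inr hwL)) hbQ hbE₀
    exact hQE₀ ⟨0, hz.somePath.source⟩
  · -- flatness at the windows
    rw [hE]
    ext z
    constructor
    · rintro ⟨hzE, hzb⟩
      refine ⟨?_, hzb⟩
      have hzL : z ∉ L i := fun h => (hE₀sub hzE).2 (by
        fin_cases i
        · exact Or.inl h
        · exact Or.inr h)
      rcases im_lt_or_lt_of_not_mem_diameter hzb (fun h => hzL (hseg i h)) with h | h
      · exact h
      · exfalso
        fin_cases i
        · exact Set.disjoint_left.1 hlo0 ⟨h, hzb⟩ hzE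
        · exact Set.disjoint_left.1 hlo1 ⟨h, hzb⟩ hzE
    · rintro ⟨hzim, hzb⟩
      refine ⟨?_, hzb⟩
      fin_cases i
      · exact hup0E₀ ⟨hzim, hzb⟩
      · exact hup1E₀ ⟨hzim, hzb⟩
  · -- the frontier
    rw [hE]
    refine hfrE₀.trans (union_subset (fun z hz => Or.inl (Or.inr hz)) ?_)
    exact hfrX₀.trans (union_subset (fun z hz => Or.inl (Or.inl hz)) fun z hz => Or.inr hz)

end Summit.CriticalPhenomena.SAWScalingLimit.Theorems.ObservableToSLER.Squeeze

end
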